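import Literature.NumberTheory.Transcendental.AyoubRelativeStokes

/-!
# Ayoub's relative Kontsevich–Zagier theorem revisited — substitutions `z_l ↦ r`

Infrastructure (one honest definition, `subst`, and its calculus) on top of
`Literature/NumberTheory/Transcendental/AyoubRelative.lean` (objects `O k = 𝒪 = k[z, t, t⁻¹]`,
`dz`, `restr`, `mapCoeff`, `Odagger k = 𝒪†_alg`, and the NAMED FACT
`Literature.NumberTheory.Transcendental.AyoubRel.ayoub_relativeKZ_revisited` = Théorème 1.7 of
J. Ayoub, *La version relative de la conjecture des périodes de Kontsevich–Zagier revisitée*,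
Tohoku Math. J. (2) 71 (2019) 465–485), `…Algebraicity.lean` (restrictions and injective
endomorphisms preserve `𝒪†_alg`) and `…Stokes.lean` (`zvar`, `dz_pow_succ`, `restr_zvar_of_ne`).
It is used by `…Loops.lean` (pull-backs of algebraic 1-forms along closed polynomial loops are
relations — an infinite family of instances of the hard inclusion of Théorème 1.7).

## Contents

* `subst l r : 𝒪 →ₐ[k] 𝒪`, the `k`-algebra endomorphism `z_l ↦ r` fixing every other variable
  (`subst_mono`, `subst_zvar_self`, `subst_zvar_eq_self`, `restr_eq_subst`); "`f` does not
  involve `z_l`" is expressed as `restr k l 0 f = f` (`restr_zero_eq_self_iff`: equivalently, no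
  monomial of `f` contains `z_l`).
* `z_l`-free elements are fixed by `subst l r`, killed by `∂/∂z_l`, fixed by `|_{z_l = c}`.
* For `r` free of `z_l`: `subst l r = (·)|_{z_l=0} ∘ τ` with `τ : z_l ↦ z_l + r` an AUTOMORPHISM
  (`subst_translate_translate`, `restr_comp_translate`), hence the coefficientwise `subst l r`
  preserves `𝒪†_alg` (`mapCoeff_subst_mem_odagger`).
* Commutation with restrictions in another variable (`restr_subst`), the chain rule
  `∂ⱼ(f(z_l := r)) = (∂_l f)(z_l := r) · ∂ⱼr` for `f` free of `zⱼ` (`dz_subst`), also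
  coefficientwise (`mapCoeff_dz_subst`), and commutation of restrictions / derivatives in two
  different variables (`restr_comm`, `restr_dz_of_ne`).

## References

* J. Ayoub, *La version relative de la conjecture des périodes de Kontsevich–Zagier revisitée*,
  Tohoku Math. J. (2) 71 (2019) 465–485, Notation 1.6, Théorème 1.7 (bib key `AyoubRelKZRevisited`).
-/

noncomputable section

open Polynomial

namespace Literature.NumberTheory.Transcendental.AyoubRel

variable {k : Type} [Field k]

/-! ### 1. The substitution endomorphisms -/

variable (k) in
/-- **Substitution `z_l ↦ r`**: the `k`-algebra endomorphism of `𝒪 = k[z, t, t⁻¹]` sending `z_l`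
to `r ∈ 𝒪` and fixing all other variables, `z^a t^b ↦ r^{a_l} · z^{a|a_l:=0} t^b`. [folklore] -/
def subst (l : ℕ) (r : O k) : O k →ₐ[k] O k :=
  AddMonoidAlgebra.lift k (O k) Mono
    { toFun := fun m => r ^ ((Multiplicative.toAdd m).1 l) *
        mono k ((Multiplicative.toAdd m).1.erase l, (Multiplicative.toAdd m).2)
      map_one' := by
        simp only [toAdd_one, Prod.fst_zero, Finsupp.coe_zero, Pi.zero_apply, pow_zero,
          Finsupp.erase_zero, Prod.snd_zero, one_mul]
        exact mono_zero
      map_mul' := fun m m' => by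
        simp only [toAdd_mul, Prod.fst_add, Prod.snd_add, Finsupp.add_apply, pow_add,
          Finsupp.erase_add]
        rw [← Prod.mk_add_mk, ← mono_mul_mono]
        ring }

/-- `subst` on monomials. [folklore] -/
theorem subst_mono (l : ℕ) (r : O k) (m : Mono) :
    subst k l r (mono k m) = r ^ (m.1 l) * mono k (m.1.erase l, m.2) := by
  show AddMonoidAlgebra.lift k (O k) Mono _ (AddMonoidAlgebra.single m 1) = _
  rw [AddMonoidAlgebra.lift_single, one_smul]
  rfl

/-- `subst l r (z_l) = r`. [folklore] -/
theorem subst_zvar_self (l : ℕ) (r : O k) : subst k l r (zvar k l) = r := by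
  rw [zvar, subst_mono]
  dsimp only
  rw [Finsupp.single_eq_same, pow_one, Finsupp.erase_single, ← Prod.zero_eq_mk, mono_zero, mul_one]

/-- `subst l r` fixes the `z_l`-free monomials. [folklore] -/
theorem subst_mono_of_eq_zero (l : ℕ) (r : O k) {m : Mono} (hm : m.1 l = 0) :
    subst k l r (mono k m) = mono k m := by
  rw [subst_mono, hm, pow_zero, one_mul, Finsupp.erase_of_notMem_support]
  simpa using hm

/-- Substituting `z_l` for itself is the identity. [folklore] -/
theorem subst_zvar_eq_self (l : ℕ) (f : O k) : subst k l (zvar k l) f = f := by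
  induction f using AddMonoidAlgebra.induction_linear with
  | zero => rw [map_zero]
  | add f g hf hg => rw [map_add, hf, hg]
  | single m a => rw [single_eq_smul_mono, map_smul, subst_mono, zvar, ← mono_eq_pow_mul]

/-- Restriction `z_l = c` is the substitution of the constant `c` (cf. the ad hoc construction in
`AyoubRelativeAlgebraicity.exists_translate`). [folklore] -/
theorem restr_eq_subst (l : ℕ) (c : k) (f : O k) : restr k l c f = subst k l (algebraMap k (O k) c) f := by
  induction f using AddMonoidAlgebra.induction_linear with
  | zero => rw [map_zero, map_zero]
  | add f g hf hg => rw [map_add, map_add, hf, hg]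
  | single m a => rw [single_eq_smul_mono, map_smul, map_smul, subst_mono, restr_mono, ← map_pow,
      ← Algebra.smul_def]

/-! ### 2. `z_l`-free elements: `f|_{z_l=0} = f` -/

/-- Linear identities on `𝒪` can be checked on monomials. [folklore] -/
theorem linearMap_ext_of_mono {f g : O k →ₗ[k] O k} (h : ∀ m : Mono, f (mono k m) = g (mono k m)) :
    f = g :=
  (AddMonoidAlgebra.basis Mono k).ext fun m => by simpa only [AddMonoidAlgebra.basis_apply, mono] using h m

/-- `(·)|_{z_l=0}` on monomials: keeps the `z_l`-free ones, kills the others. [folklore] -/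
theorem restr_zero_mono (l : ℕ) (m : Mono) :
    restr k l 0 (mono k m) = if m.1 l = 0 then mono k m else 0 := by
  rw [restr_mono]
  split_ifs with h
  · rw [h, pow_zero, one_smul, Finsupp.erase_of_notMem_support]
    simpa using h
  · rw [zero_pow h, zero_smul]

/-- Coefficients of `f|_{z_l=0}`: those of the `z_l`-free monomials of `f`. [folklore] -/
theorem coeff_restr_zero_eq_ite (l : ℕ) (f : O k) (m : Mono) :
    (restr k l 0 f).coeff m = if m.1 l = 0 then f.coeff m else 0 := by
  classical
  induction f using AddMonoidAlgebra.induction_linear with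
  | zero => simp
  | add f g hf hg =>
    simp only [map_add, AddMonoidAlgebra.coeff_add, Finsupp.add_apply, hf, hg]
    split_ifs <;> simp
  | single μ a =>
    rw [single_eq_smul_mono, map_smul, restr_zero_mono]
    by_cases hμ : μ.1 l = 0
    · rw [if_pos hμ]
      split_ifs with hm
      · rfl
      · have hne : m ≠ μ := fun h => hm (h ▸ hμ)
        rw [AddMonoidAlgebra.coeff_smul, Finsupp.smul_apply, mono, AddMonoidAlgebra.coeff_single,
          Finsupp.single_eq_of_ne hne, smul_zero]
    · rw [if_neg hμ, smul_zero, AddMonoidAlgebra.coeff_zero, Finsupp.zero_apply]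
      split_ifs with hm
      · have hne : m ≠ μ := fun h => hμ (h ▸ hm)
        rw [AddMonoidAlgebra.coeff_smul, Finsupp.smul_apply, mono, AddMonoidAlgebra.coeff_single,
          Finsupp.single_eq_of_ne hne, smul_zero]
      · rfl

/-- **"`f` does not involve `z_l`"**: `f|_{z_l=0} = f` iff no monomial of `f` contains `z_l`.
[folklore] -/
theorem restr_zero_eq_self_iff (l : ℕ) (f : O k) :
    restr k l 0 f = f ↔ ∀ m ∈ f.coeff.support, m.1 l = 0 := by
  constructor
  · intro h m hm
    by_contra hml
    have := congrArg (fun g : O k => g.coeff m) h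
    simp only [coeff_restr_zero_eq_ite, if_neg hml] at this
    exact Finsupp.mem_support_iff.mp hm this.symm
  · intro h
    apply AddMonoidAlgebra.coeff_injective
    ext m
    rw [coeff_restr_zero_eq_ite]
    split_ifs with hm
    · rfl
    · exact (Finsupp.notMem_support_iff.mp fun hm' => hm (h m hm')).symm

/-- `subst l r ∘ (·)|_{z_l=0} = (·)|_{z_l=0}`. [folklore] -/
theorem subst_comp_restr_zero (l : ℕ) (r : O k) :
    (subst k l r).toLinearMap ∘ₗ restr k l 0 = restr k l 0 :=
  linearMap_ext_of_mono fun m => by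
    rw [LinearMap.comp_apply, restr_zero_mono]
    split_ifs with h
    · exact subst_mono_of_eq_zero l r h
    · exact map_zero _

/-- **`z_l`-free elements are fixed by every substitution `z_l ↦ r`.** [folklore] -/
theorem subst_of_restr_eq (l : ℕ) (r : O k) {f : O k} (hf : restr k l 0 f = f) : subst k l r f = f := by
  conv_lhs => rw [← hf]
  exact (LinearMap.congr_fun (subst_comp_restr_zero l r) f).trans hf

/-- `∂/∂z_l ∘ (·)|_{z_l=0} = 0`. [folklore] -/
theorem dz_comp_restr_zero (l : ℕ) : dz k l ∘ₗ restr k l 0 = 0 :=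
  linearMap_ext_of_mono fun m => by
    rw [LinearMap.comp_apply, restr_zero_mono, LinearMap.zero_apply]
    split_ifs with h
    · rw [dz_mono, h, Nat.cast_zero, zero_smul]
    · exact map_zero _

/-- **`z_l`-free elements are killed by `∂/∂z_l`.** [folklore] -/
theorem dz_of_restr_eq (l : ℕ) {f : O k} (hf : restr k l 0 f = f) : dz k l f = 0 := by
  conv_lhs => rw [← hf]
  exact LinearMap.congr_fun (dz_comp_restr_zero l) f

/-- `(·)|_{z_l=c} ∘ (·)|_{z_l=0} = (·)|_{z_l=0}`. [folklore] -/
theorem restr_comp_restr_zero (l : ℕ) (c : k) : restr k l c ∘ₗ restr k l 0 = restr k l 0 :=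
  linearMap_ext_of_mono fun m => by
    rw [LinearMap.comp_apply, restr_zero_mono]
    split_ifs with h
    · rw [restr_mono, h, pow_zero, one_smul, Finsupp.erase_of_notMem_support]
      simpa using h
    · exact map_zero _

/-- **`z_l`-free elements are fixed by `(·)|_{z_l=c}`.** [folklore] -/
theorem restr_of_restr_eq (l : ℕ) (c : k) {f : O k} (hf : restr k l 0 f = f) : restr k l c f = f := by
  conv_lhs => rw [← hf]
  exact (LinearMap.congr_fun (restr_comp_restr_zero l c) f).trans hf

/-- Products of `z_l`-free elements are `z_l`-free. [folklore] -/
theorem restr_zero_mul_of_restr_eq (l : ℕ) {f g : O k} (hf : restr k l 0 f = f)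
    (hg : restr k l 0 g = g) : restr k l 0 (f * g) = f * g := by
  rw [restr_mul, hf, hg]

/-! ### 3. `subst l r` preserves `𝒪†_alg` when `r` is free of `z_l` -/

/-- The translation `z_l ↦ z_l + r` followed by `z_l ↦ z_l - r` is the identity when `r` is free
of `z_l`. [folklore] -/
theorem subst_translate_translate (l : ℕ) {r : O k} (hr : restr k l 0 r = r) (f : O k) :
    subst k l (zvar k l - r) (subst k l (zvar k l + r) f) = f := by
  induction f using AddMonoidAlgebra.induction_linear with
  | zero => rw [map_zero, map_zero]
  | add f g hf hg => rw [map_add, map_add, hf, hg]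
  | single m a =>
    rw [single_eq_smul_mono, map_smul, map_smul, subst_mono, map_mul, map_pow, map_add,
      subst_zvar_self, subst_of_restr_eq l _ hr, sub_add_cancel,
      subst_mono_of_eq_zero l _ (Finsupp.erase_same (a := l) (f := m.1)), zvar, ← mono_eq_pow_mul]

/-- `(·)|_{z_l=0} ∘ (z_l ↦ z_l + r) = subst l r` when `r` is free of `z_l`. [folklore] -/
theorem restr_comp_translate (l : ℕ) {r : O k} (hr : restr k l 0 r = r) (f : O k) :
    restr k l 0 (subst k l (zvar k l + r) f) = subst k l r f := by
  induction f using AddMonoidAlgebra.induction_linear with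
  | zero => rw [map_zero, map_zero, map_zero]
  | add f g hf hg => rw [map_add, map_add, map_add, hf, hg]
  | single m a =>
    let ρ : O k →ₐ[k] O k := AlgHom.ofLinearMap (restr k l 0) (restr_one l 0) (restr_mul l 0)
    have hρ : ∀ f, restr k l 0 f = ρ f := fun _ => rfl
    rw [single_eq_smul_mono, map_smul, map_smul, map_smul, subst_mono, subst_mono, hρ, map_mul,
      map_pow, map_add, ← hρ, ← hρ, ← hρ, hr, restr_zvar_self, map_zero, zero_add, restr_mono]
    dsimp only
    rw [Finsupp.erase_same, pow_zero, one_smul,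
      Finsupp.erase_of_notMem_support (f := m.1.erase l) (by simp)]

/-- **Substituting a `z_l`-free `r` for `z_l` preserves `𝒪†_alg`** (coefficientwise in `ϖ`).
[folklore] -/
theorem mapCoeff_subst_mem_odagger (l : ℕ) {r : O k} (hr : restr k l 0 r = r)
    {F : LaurentSeries (O k)} (hF : F ∈ Odagger k) :
    mapCoeff k (subst k l r).toLinearMap F ∈ Odagger k := by
  set τ := subst k l (zvar k l + r) with hτ
  have hinj : Function.Injective τ :=
    Function.LeftInverse.injective (g := subst k l (zvar k l - r)) (subst_translate_translate l hr)
  have h1 : (subst k l r).toLinearMap = restr k l 0 ∘ₗ τ.toLinearMap :=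
    LinearMap.ext fun f => (restr_comp_translate l hr f).symm
  rw [h1, mapCoeff_comp_apply]
  exact mapCoeff_restr_zero_mem_odagger l
    (mapCoeff_mem_odagger_of_injective τ.toLinearMap (map_one τ) (map_mul τ) hinj hF)

/-! ### 4. Commutation with restrictions, and the chain rule -/

/-- **Restriction in another variable commutes with substitution**:
`(f(z_l := r))|_{zⱼ=c} = (f|_{zⱼ=c})(z_l := r|_{zⱼ=c})` for `j ≠ l`. [folklore] -/
theorem restr_subst {l j : ℕ} (h : j ≠ l) (c : k) (r f : O k) :
    restr k j c (subst k l r f) = subst k l (restr k j c r) (restr k j c f) := by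
  induction f using AddMonoidAlgebra.induction_linear with
  | zero => rw [map_zero, map_zero, map_zero]
  | add f g hf hg => simp only [map_add, hf, hg]
  | single m a =>
    let ρ : O k →ₐ[k] O k := AlgHom.ofLinearMap (restr k j c) (restr_one j c) (restr_mul j c)
    have hρ : ∀ f, restr k j c f = ρ f := fun _ => rfl
    have hcomm : (m.1.erase l).erase j = (m.1.erase j).erase l := by
      ext x
      by_cases hxj : x = j
      · subst hxj; rw [Finsupp.erase_same, Finsupp.erase_ne h, Finsupp.erase_same]
      · by_cases hxl : x = l
        · subst hxl; rw [Finsupp.erase_same, Finsupp.erase_ne hxj, Finsupp.erase_same]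
        · rw [Finsupp.erase_ne hxj, Finsupp.erase_ne hxl, Finsupp.erase_ne hxl, Finsupp.erase_ne hxj]
    rw [single_eq_smul_mono, map_smul, map_smul, map_smul, map_smul, subst_mono, hρ, map_mul,
      map_pow, ← hρ, ← hρ, restr_mono, restr_mono, map_smul, subst_mono]
    dsimp only
    rw [Finsupp.erase_ne h, Finsupp.erase_ne h.symm, hcomm, mul_smul_comm]

/-- **Chain rule**: for `f` free of `zⱼ`, `∂ⱼ (f(z_l := r)) = (∂_l f)(z_l := r) · ∂ⱼ r`.
(For `j = l` both sides vanish.) [folklore] -/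
theorem dz_subst (l j : ℕ) (r : O k) {f : O k} (hf : restr k j 0 f = f) :
    dz k j (subst k l r f) = subst k l r (dz k l f) * dz k j r := by
  rcases eq_or_ne j l with rfl | h
  · rw [subst_of_restr_eq j r hf, dz_of_restr_eq j hf, map_zero, zero_mul]
  -- `j ≠ l`: reduce to `z_j`-free monomials via `f = f|_{zⱼ=0}`
  suffices H : ∀ m : Mono, m.1 j = 0 →
      dz k j (subst k l r (mono k m)) = subst k l r (dz k l (mono k m)) * dz k j r by
    suffices H' : ∀ g : O k,
        dz k j (subst k l r (restr k j 0 g)) = subst k l r (dz k l (restr k j 0 g)) * dz k j r by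
      simpa only [hf] using H' f
    intro g
    induction g using AddMonoidAlgebra.induction_linear with
    | zero => simp
    | add f g hf' hg' => simp only [map_add, hf', hg', add_mul]
    | single m a =>
      rw [single_eq_smul_mono, map_smul, restr_zero_mono]
      split_ifs with hm
      · rw [map_smul, map_smul, H m hm, map_smul, map_smul, smul_mul_assoc]
      · simp
  intro m hm
  have h0 : dz k j (mono k (m.1.erase l, m.2)) = 0 := by
    rw [dz_mono]
    dsimp only
    rw [Finsupp.erase_ne h, hm, Nat.cast_zero, zero_smul]
  rw [subst_mono, dz_mul, h0, mul_zero, add_zero, dz_mono l m, map_smul, subst_mono]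
  dsimp only
  rcases Nat.eq_zero_or_pos (m.1 l) with hl | hl
  · rw [hl, pow_zero, Nat.cast_zero, zero_smul, zero_mul, map_one_of_leibniz _ (dz_mul j), zero_mul]
  · obtain ⟨a, ha⟩ : ∃ a, m.1 l = a + 1 := ⟨m.1 l - 1, by omega⟩
    have he : (m.1 - Finsupp.single l 1 : ℕ →₀ ℕ).erase l = m.1.erase l := by
      ext x
      by_cases hx : x = l
      · subst hx; rw [Finsupp.erase_same, Finsupp.erase_same]
      · rw [Finsupp.erase_ne hx, Finsupp.erase_ne hx, Finsupp.tsub_apply, Finsupp.single_apply,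
          if_neg (Ne.symm hx), Nat.sub_zero]
    have hl' : (m.1 - Finsupp.single l 1 : ℕ →₀ ℕ) l = a := by
      rw [Finsupp.tsub_apply, Finsupp.single_eq_same, ha, Nat.add_sub_cancel]
    rw [ha, dz_pow_succ, he, hl', Nat.cast_smul_eq_nsmul, nsmul_eq_mul]
    push_cast
    ring

/-- **Chain rule, coefficientwise**: for `r ∈ 𝒪` and a Laurent series `E` all of whose
coefficients are free of `zⱼ`, `∂ⱼ(E(z_l := r)) = (∂_l E)(z_l := r) · ∂ⱼr`. [folklore] -/
theorem mapCoeff_dz_subst (l j : ℕ) (r : O k) {E : LaurentSeries (O k)}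
    (hE : mapCoeff k (restr k j 0) E = E) :
    mapCoeff k (dz k j) (mapCoeff k (subst k l r).toLinearMap E) =
      dz k j r • mapCoeff k (subst k l r).toLinearMap (mapCoeff k (dz k l) E) := by
  refine HahnSeries.ext (funext fun n => ?_)
  have hn : restr k j 0 (E.coeff n) = E.coeff n := by
    have := congrArg (fun G : LaurentSeries (O k) => G.coeff n) hE
    simpa only [mapCoeff_coeff] using this
  rw [HahnSeries.coeff_smul, mapCoeff_coeff, mapCoeff_coeff, mapCoeff_coeff, mapCoeff_coeff,
    AlgHom.toLinearMap_apply, AlgHom.toLinearMap_apply, dz_subst l j r hn, smul_eq_mul, mul_comm]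

/-- **Restriction commutes with substitution, coefficientwise** (`j ≠ l`). [folklore] -/
theorem mapCoeff_restr_subst {l j : ℕ} (h : j ≠ l) (c : k) (r : O k) (E : LaurentSeries (O k)) :
    mapCoeff k (restr k j c) (mapCoeff k (subst k l r).toLinearMap E) =
      mapCoeff k (subst k l (restr k j c r)).toLinearMap (mapCoeff k (restr k j c) E) := by
  refine HahnSeries.ext (funext fun n => ?_)
  simp only [mapCoeff_coeff, AlgHom.toLinearMap_apply, restr_subst h]

/-! ### 5. Restrictions and derivatives in two different variables commute -/

/-- Restrictions in two different variables commute. [folklore] -/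
theorem restr_comm {i l : ℕ} (h : i ≠ l) (c c' : k) (f : O k) :
    restr k i c (restr k l c' f) = restr k l c' (restr k i c f) := by
  induction f using AddMonoidAlgebra.induction_linear with
  | zero => simp
  | add f g hf hg => simp only [map_add, hf, hg]
  | single m a =>
    have hcomm : (m.1.erase l).erase i = (m.1.erase i).erase l := by
      ext x
      by_cases hxi : x = i
      · subst hxi; rw [Finsupp.erase_same, Finsupp.erase_ne h, Finsupp.erase_same]
      · by_cases hxl : x = l
        · subst hxl; rw [Finsupp.erase_same, Finsupp.erase_ne hxi, Finsupp.erase_same]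
        · rw [Finsupp.erase_ne hxi, Finsupp.erase_ne hxl, Finsupp.erase_ne hxl, Finsupp.erase_ne hxi]
    simp only [single_eq_smul_mono, map_smul, restr_mono, smul_smul]
    rw [Finsupp.erase_ne h, Finsupp.erase_ne h.symm, hcomm]
    congr 1
    ring

/-- `∂/∂zᵢ` commutes with `(·)|_{zⱼ=c}` for `i ≠ j`. [folklore] -/
theorem restr_dz_of_ne {i j : ℕ} (h : i ≠ j) (c : k) (f : O k) :
    restr k j c (dz k i f) = dz k i (restr k j c f) := by
  induction f using AddMonoidAlgebra.induction_linear with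
  | zero => simp
  | add f g hf hg => simp only [map_add, hf, hg]
  | single m a =>
    have he : (m.1 - Finsupp.single i 1 : ℕ →₀ ℕ).erase j = m.1.erase j - Finsupp.single i 1 := by
      ext x
      by_cases hxj : x = j
      · subst hxj
        rw [Finsupp.erase_same, Finsupp.tsub_apply, Finsupp.erase_same, Finsupp.single_apply,
          if_neg h, Nat.zero_sub]
      · rw [Finsupp.erase_ne hxj, Finsupp.tsub_apply, Finsupp.tsub_apply, Finsupp.erase_ne hxj]
    simp only [single_eq_smul_mono, map_smul, restr_mono, dz_mono, smul_smul]
    rw [Finsupp.tsub_apply, Finsupp.single_apply, if_neg h, Nat.sub_zero, Finsupp.erase_ne h, he]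
    congr 1
    ring

/-- Hence `∂/∂zᵢ` of a `zⱼ`-free element is `zⱼ`-free (`i ≠ j`). [folklore] -/
theorem restr_zero_dz_of_restr_eq {i j : ℕ} (h : i ≠ j) {f : O k} (hf : restr k j 0 f = f) :
    restr k j 0 (dz k i f) = dz k i f := by
  rw [restr_dz_of_ne h, hf]

/-- … and a restriction `(·)|_{zᵢ=c}` of a `zⱼ`-free element is `zⱼ`-free (`i ≠ j`). [folklore] -/
theorem restr_zero_restr_of_restr_eq {i j : ℕ} (h : i ≠ j) (c : k) {f : O k}
    (hf : restr k j 0 f = f) : restr k j 0 (restr k i c f) = restr k i c f := by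
  rw [restr_comm h.symm, hf]

end Literature.NumberTheory.Transcendental.AyoubRel
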